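import Mathlib.Algebra.Polynomial.Bivariate
import Mathlib.RingTheory.Localization.Integral
import Mathlib.RingTheory.Polynomial.ScaleRoots
import Mathlib.RingTheory.Polynomial.UniqueFactorization
import Mathlib.FieldTheory.IsAlgClosed.Basic
import Mathlib.FieldTheory.RatFunc.AsPolynomial
import Mathlib.RingTheory.PowerBasis
import Mathlib.FieldTheory.Minpoly.Field
import Mathlib.RingTheory.IntegralClosure.IntegrallyClosed
import HarnessLib

/-!
# Absolutely irreducible plane curves have full constant field `K`

For a field `K`, an algebraically closed field `K̄` with `σ : K → K̄`, and a bivariate polynomial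
`Φ ∈ K[X][Y]`, monic in `Y`, whose image in `K̄[X][Y]` is irreducible (*absolute irreducibility*),
the function field `F = K(X)[Y]/(Φ)` of the plane curve `Φ = 0` has full constant field `K`:
every element of `F` algebraic over `K` lies in `K` (`isIntegrallyClosedIn_of_irreducible_map`,
stated for any field `F` with a power basis over `RatFunc K` whose generator has minimal
polynomial `Φ`). This is the standard fact "a variety is geometrically irreducible iff it is
irreducible and `K` is algebraically closed in its function field" in the direction and generality
needed for counting rational points on absolutely irreducible plane curves over finite fields via
the Hasse–Weil theorem (Cafure–Matera 2006, proof of Thm. 5.4; Stichtenoth Cor. 3.6.8 for the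
function-field formulation).

## Proof (`eq_C_of_map_dvd_aeval`)

Let `z = r(y) ∈ F` (`r ∈ K(X)[Y]`, `deg r < d = deg_Y Φ`) satisfy `μ(z) = 0` with `μ ∈ K[T]` monic.
Then `Φ ∣ μ(r)` in `K(X)[Y]`. Clearing denominators, `r = R/D` with `R ∈ K[X][Y]`, `D ∈ K[X]`,
and with the homogenisation `H(T) = D^m μ(T/D) ∈ K[X][T]` (`Polynomial.scaleRoots`) one gets
`Φ ∣ H(R)` in `K(X)[Y]`, hence in `K[X][Y]` (`Φ` is monic: Gauss), hence `Φ̄ ∣ H̄(R̄)` in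
`K̄[X][Y]`. Over `K̄`, `μ = ∏ (T - ζᵢ)` and `H̄(R̄) = ∏ (R̄ - ζᵢ D̄)`; `Φ̄` is prime (irreducible in
the factorial ring `K̄[X][Y]`), so `Φ̄ ∣ R̄ - ζᵢ D̄` for some `i`, and comparing `Y`-degrees
`R̄ = ζᵢ D̄`. Comparing a coefficient, `ζᵢ = σ(c)` with `c ∈ K`, `R = c D`, and `r = c` is a
constant: `z = c ∈ K`.

## References

* H. Stichtenoth, *Algebraic Function Fields and Codes*, 2nd ed., GTM 254, Springer 2009,
  Cor. 3.6.8 (constant field vs. irreducibility over `K̄`). [Stichtenoth2009]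
* A. Cafure, G. Matera, Finite Fields Appl. 12 (2006) 155–185, §2 ("absolutely irreducible") and
  proof of Thm. 5.4. [CafureMatera2006]
-/

noncomputable section

open scoped Classical Polynomial.Bivariate
open Polynomial

namespace Literature.NumberTheory.DiophantineGeometry.AlgFunctionField

universe u

variable {K : Type u} [Field K]

/-! ### Small polynomial lemmas -/

/-- `scaleRoots` is multiplicative on multiset products over a domain. [folklore] -/
theorem multiset_prod_scaleRoots {A : Type*} [CommRing A] [NoZeroDivisors A]
    (s : Multiset A[X]) (t : A) :
    s.prod.scaleRoots t = (s.map fun p ↦ p.scaleRoots t).prod := by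
  induction s using Multiset.induction_on with
  | empty => simp
  | cons p s ih => rw [Multiset.prod_cons, Multiset.map_cons, Multiset.prod_cons,
      mul_scaleRoots_of_noZeroDivisors, ih]

/-- A polynomial over `K` whose image under a field embedding `σ` is `a • (D.map σ)` with `D ≠ 0`
is `c • D` for some `c ∈ K` with `σ c = a`. [folklore] -/
theorem exists_eq_C_mul_of_map_eq {Kbar : Type*} [Field Kbar] (σ : K →+* Kbar) {R₀ D : K[X]}
    (hD : D ≠ 0) {a : Kbar} (h : R₀.map σ = C a * D.map σ) :
    ∃ c : K, σ c = a ∧ R₀ = C c * D := by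
  set k := D.natDegree with hk
  have hDk : D.coeff k ≠ 0 := leadingCoeff_ne_zero.2 hD
  have hcoeff : σ (R₀.coeff k) = a * σ (D.coeff k) := by
    have := congrArg (fun p : Kbar[X] ↦ p.coeff k) h
    simpa [coeff_map, coeff_C_mul] using this
  refine ⟨R₀.coeff k / D.coeff k, ?_, ?_⟩
  · rw [map_div₀, hcoeff, mul_div_cancel_right₀ _ ((map_ne_zero σ).2 hDk)]
  · apply map_injective σ σ.injective
    rw [h, Polynomial.map_mul, map_C, map_div₀, hcoeff,
      mul_div_cancel_right₀ _ ((map_ne_zero σ).2 hDk)]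

/-! ### The key algebraic lemma -/

/-- **Key lemma.** Let `Φ ∈ K[X][Y]` be monic in `Y` with irreducible image in `K̄[X][Y]`
(`K̄` algebraically closed, `σ : K → K̄`), `μ ∈ K[T]` monic, and `r ∈ K(X)[Y]` with
`deg r < deg_Y Φ` and `Φ ∣ μ(r)` in `K(X)[Y]`. Then `r` is a constant from `K`. (Proof in the
module docstring: clear denominators, homogenise `μ` with `scaleRoots`, descend the divisibility
to `K[X][Y]` by Gauss, pass to `K̄[X][Y]` where `μ` splits and `Φ̄` is prime, compare degrees.)
[folklore] -/
theorem eq_C_of_map_dvd_aeval {Kbar : Type*} [Field Kbar] [IsAlgClosed Kbar] (σ : K →+* Kbar)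
    {Φ : K[X][Y]} (hm : Φ.Monic) (hirr : Irreducible (Φ.map (mapRingHom σ)))
    {μ : K[X]} (hμ : μ.Monic) {r : (RatFunc K)[X]} (hr : r.natDegree < Φ.natDegree)
    (hdvd : Φ.map (algebraMap K[X] (RatFunc K)) ∣ aeval r μ) :
    ∃ c : K, r = C (algebraMap K (RatFunc K) c) := by
  set L := RatFunc K
  set i : K[X] →+* RatFunc K := algebraMap K[X] (RatFunc K) with hi
  have hi_inj : Function.Injective i := IsFractionRing.injective K[X] (RatFunc K)
  set τ : K[X] →+* Kbar[X] := mapRingHom σ with hτ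
  have hτ_inj : Function.Injective τ := map_injective σ σ.injective
  -- Step 1: clear denominators, `R.map i = D • r`
  obtain ⟨D, hDM, hRD⟩ := IsLocalization.integerNormalization_spec (nonZeroDivisors K[X]) r
  set R : K[X][Y] := IsLocalization.integerNormalization (nonZeroDivisors K[X]) r with hR
  have hRD' : R.map i = D • r := hRD
  have hD0 : D ≠ 0 := nonZeroDivisors.ne_zero hDM
  have hiD0 : i D ≠ 0 := (map_ne_zero_iff i hi_inj).2 hD0
  have hRdeg : R.natDegree < Φ.natDegree := by
    refine lt_of_le_of_lt ?_ hr
    rw [natDegree_le_iff_coeff_eq_zero]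
    intro n hn
    have hn' : n ∉ r.support := fun h ↦ by
      have := le_natDegree_of_mem_supp n h
      exact absurd this (not_le.2 hn)
    exact notMem_support_iff.1 fun h ↦ hn' (IsLocalization.integerNormalization_support _ r h)
  have hsmul : (D • r : (RatFunc K)[X]) = C (i D) * r := by
    rw [Algebra.smul_def, Polynomial.algebraMap_apply]
  -- Step 2: the homogenised polynomial `H` and `G = H(R)`; `Φ ∣ G` over `K(X)`
  set m := μ.natDegree with hmdef
  set H : K[X][X] := (μ.map (algebraMap K K[X])).scaleRoots D with hH
  set G : K[X][Y] := aeval R H with hG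
  have hμj : (μ.map (algebraMap K K[X])).Monic := hμ.map _
  have hHi : H.map i = (μ.map (algebraMap K (RatFunc K))).scaleRoots (i D) := by
    rw [hH, map_scaleRoots _ _ _ (by rw [hμj.leadingCoeff, map_one]; exact one_ne_zero),
      Polynomial.map_map, ← IsScalarTower.algebraMap_eq K K[X] (RatFunc K)]
  have hsq_i : (algebraMap (RatFunc K) (RatFunc K)[X]).comp i =
      (mapRingHom i).comp (algebraMap K[X] K[X][X]) := by
    ext p <;> simp
  have hGi : G.map i = C (i D) ^ m * aeval r μ := by
    have h1 : (mapRingHom i) G = aeval ((mapRingHom i) R) (H.map i) :=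
      map_aeval_eq_aeval_map hsq_i H R
    simp only [coe_mapRingHom] at h1
    rw [h1, hRD', hsmul, hHi, aeval_def, aeval_def, Polynomial.algebraMap_eq,
      scaleRoots_eval₂_mul, hμ.natDegree_map]
    congr 1
    rw [eval₂_map, IsScalarTower.algebraMap_eq K (RatFunc K) (RatFunc K)[X]]
    rfl
  have h2 : Φ.map i ∣ G.map i := by
    rw [hGi]
    exact dvd_mul_of_dvd_right hdvd _
  -- Step 3: descend to `K[X][Y]` (Gauss, `Φ` monic)
  have h3 : Φ ∣ G := (Polynomial.map_dvd_map i hi_inj hm).1 h2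
  -- Step 4: pass to `K̄[X][Y]`
  have h4 : Φ.map τ ∣ G.map τ := Polynomial.map_dvd τ h3
  have hsq_τ : (algebraMap Kbar[X] Kbar[X][X]).comp τ =
      (mapRingHom τ).comp (algebraMap K[X] K[X][X]) := by
    ext p <;> simp [hτ]
  set μbar : Kbar[X] := μ.map σ with hμbar
  set Dbar : Kbar[X] := D.map σ with hDbar
  set Rbar : Kbar[X][Y] := R.map τ with hRbar
  have hμbar_m : μbar.Monic := hμ.map σ
  have hHτ : H.map τ = (μbar.map (algebraMap Kbar Kbar[X])).scaleRoots Dbar := by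
    rw [hH, map_scaleRoots _ _ _ (by rw [hμj.leadingCoeff, map_one]; exact one_ne_zero),
      Polynomial.map_map, hμbar, Polynomial.map_map]
    congr 1
    · congr 1
      ext c
      simp [hτ]
  -- Step 5: `μ̄` splits, so `H̄ = ∏ (T - ζ D̄)` and `Ḡ = ∏ (R̄ - ζ D̄)`
  have hsplit : μbar = (μbar.roots.map (X - C ·)).prod :=
    (IsAlgClosed.splits μbar).eq_prod_roots_of_monic hμbar_m
  have hHτ' : H.map τ = (μbar.roots.map fun a ↦ X - C (C a * Dbar)).prod := by
    rw [hHτ]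
    conv_lhs => rw [hsplit]
    rw [Polynomial.map_multiset_prod, Multiset.map_map, multiset_prod_scaleRoots,
      Multiset.map_map]
    congr 1
    refine Multiset.map_congr rfl fun a _ ↦ ?_
    simp only [Function.comp_apply, Polynomial.map_sub, map_X, map_C, X_sub_C_scaleRoots,
      Polynomial.algebraMap_eq]
  have hGτ : G.map τ = (μbar.roots.map fun a ↦ Rbar - C (C a * Dbar)).prod := by
    have h1 : (mapRingHom τ) G = aeval ((mapRingHom τ) R) (H.map τ) :=
      map_aeval_eq_aeval_map hsq_τ H R
    simp only [coe_mapRingHom] at h1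
    rw [h1, hHτ', map_multiset_prod, Multiset.map_map]
    congr 1
    refine Multiset.map_congr rfl fun a _ ↦ ?_
    simp only [Function.comp_apply, map_sub, aeval_X, aeval_C, Polynomial.algebraMap_eq]
    rfl
  -- Step 6: `Φ̄` is prime and divides one factor
  have hprime : Prime (Φ.map τ) := UniqueFactorizationMonoid.irreducible_iff_prime.1 hirr
  rw [hGτ] at h4
  obtain ⟨q, hq, hq'⟩ := hprime.exists_mem_multiset_dvd h4
  obtain ⟨a, _, rfl⟩ := Multiset.mem_map.1 hq
  -- Step 7: degree comparison forces `R̄ = ζ D̄`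
  have hdegΦ : (Φ.map τ).natDegree = Φ.natDegree := hm.natDegree_map τ
  have hRbarC : Rbar = C (C a * Dbar) := by
    by_contra hne
    have hne' : Rbar - C (C a * Dbar) ≠ 0 := sub_ne_zero.2 hne
    have h1 := natDegree_le_of_dvd hq' hne'
    rw [natDegree_sub_C, hdegΦ] at h1
    have h2 : Rbar.natDegree ≤ R.natDegree := natDegree_map_le
    omega
  -- Step 8: `R = C (c • D)` with `σ c = a`
  have hRdeg0 : R.natDegree = 0 := by
    rw [← natDegree_map_eq_of_injective hτ_inj R]
    change Rbar.natDegree = 0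
    rw [hRbarC, natDegree_C]
  have hRC : R = C (R.coeff 0) := eq_C_of_natDegree_le_zero hRdeg0.le
  have h8 : (R.coeff 0).map σ = C a * D.map σ := by
    have := congrArg (fun p : Kbar[X][Y] ↦ p.coeff 0) hRbarC
    simpa only [hRbar, hτ, coeff_map, coe_mapRingHom, coeff_C_zero] using this
  obtain ⟨c, hca, hc⟩ := exists_eq_C_mul_of_map_eq σ hD0 h8
  -- Step 9: back in `K(X)[Y]`, `D • r = R = c D`, so `r = c`
  refine ⟨c, ?_⟩
  have hic : i (C c) = algebraMap K (RatFunc K) c := by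
    change algebraMap K[X] (RatFunc K) (algebraMap K K[X] c) = _
    exact (IsScalarTower.algebraMap_apply K K[X] (RatFunc K) c).symm
  have h9 : C (i D) * r = C (i D) * C (algebraMap K (RatFunc K) c) := by
    rw [← hsmul, ← hRD, hRC, hc, map_C, map_mul, hic, ← C_mul, mul_comm]
  exact mul_left_cancel₀ (C_ne_zero.2 hiD0) h9

/-! ### The full constant field of an absolutely irreducible plane curve -/

/-- **Absolute irreducibility ⇒ full constant field `K`.** Let `F` be a field which is compatibly
an algebra over `K`, `K[X]` and `K(X) = RatFunc K`, with a power basis `pb` over `K(X)` whose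
generator `y` has minimal polynomial `Φ ∈ K[X][Y]` (monic in `Y`) — e.g. `F = K(X)[Y]/(Φ)`, the
function field of the plane curve `Φ = 0`. If the image of `Φ` in `K̄[X][Y]` is irreducible for
some embedding `σ : K → K̄` into an algebraically closed field, then `K` is integrally
(= algebraically) closed in `F`, i.e. `K` is the full constant field of `F/K`
(Stichtenoth Cor. 3.6.8; Cafure–Matera's standing notion "absolutely irreducible", §2).
Proof: an element `z = r(y)` integral over `K` with `μ(z) = 0` gives `Φ ∣ μ(r)` over `K(X)`, and
`eq_C_of_map_dvd_aeval` shows `r ∈ K`. [cite: Stichtenoth2009, Cor. 3.6.8] -/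
theorem isIntegrallyClosedIn_of_irreducible_map {F : Type*} [Field F] [Algebra K F]
    [Algebra K[X] F] [Algebra (RatFunc K) F] [IsScalarTower K[X] (RatFunc K) F]
    [IsScalarTower K (RatFunc K) F] (pb : PowerBasis (RatFunc K) F) {Φ : K[X][Y]} (hm : Φ.Monic)
    (hmin : minpoly (RatFunc K) pb.gen = Φ.map (algebraMap K[X] (RatFunc K)))
    {Kbar : Type*} [Field Kbar] [IsAlgClosed Kbar] (σ : K →+* Kbar)
    (hirr : Irreducible (Φ.map (mapRingHom σ))) : IsIntegrallyClosedIn K F := by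
  refine isIntegrallyClosedIn_iff.2 ⟨(algebraMap K F).injective, fun {z} hz ↦ ?_⟩
  obtain ⟨μ, hμ, hμz⟩ := hz
  obtain ⟨r, hr, rfl⟩ := pb.exists_eq_aeval z
  -- `Φ ∣ μ(r)` over `K(X)`
  have hdim : pb.dim = Φ.natDegree := by
    rw [← pb.natDegree_minpoly, hmin, hm.natDegree_map]
  have h0 : aeval pb.gen (aeval r μ) = 0 := by
    have h := aeval_algHom_apply ((aeval pb.gen).restrictScalars K) r μ
    simp only [AlgHom.coe_restrictScalars'] at h
    rw [← h, aeval_def]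
    exact hμz
  have hdvd : Φ.map (algebraMap K[X] (RatFunc K)) ∣ aeval r μ := by
    rw [← hmin]
    exact minpoly.dvd _ _ h0
  obtain ⟨c, hc⟩ := eq_C_of_map_dvd_aeval σ hm hirr hμ (hdim ▸ hr) hdvd
  refine ⟨c, ?_⟩
  rw [hc, aeval_C, ← IsScalarTower.algebraMap_apply]

end Literature.NumberTheory.DiophantineGeometry.AlgFunctionField
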